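import Mathlib
import HarnessLib
import Summits.NavierStokesRegularity.NavierStokesRegularity.Theorems.TypeIQuarterGateScarEnvelopeTypeIForcedTsaiAlgSoundX
import Summits.NavierStokesRegularity.NavierStokesRegularity.Theorems.TypeIQuarterGateScarEnvelopeTypeIForcedTsaiAlgWitnessL1X

/-!
# ARM B lane E-exact — ℓ = 1 Type-I rows at the EXACT B₁₀ level, AS TREE THEOREMS: δ/M = 14.957 @0.257 … 17.166 @4.114

Closers of kernel-checked LANEX-ALG v4 rows — EXACT level `‖ω‖_{L²(B₁₀)}` (incomplete-Beta recurrences) and EXACT residual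
weight `(1+ρ)⁵`; no floor, no majorant — through `AlgRowX.sound` (`…ForcedTsaiAlgSoundX`): certified UPPER bounds on the
forced-Tsai modulus in the tree currency (`ℝ³`, weight `(1+ρ)⁵`, level on `B₁₀`).
WITNESS: the ℓ = 1 poloidal Type-I family + exact far-field closure (8 half-integer W-powers; the witnesses of the landed L1F/L1G rows).
`δ*(0.257) ≤ 3.844` (δ/M = 14.957; v3 15.376 @ 1/4); `δ*(0.514) ≤ 7.702` (δ/M = 14.984; v3 15.404 @ 1/2); `δ*(1.028) ≤ 15.52` (δ/M = 15.093; v3 15.516 @ 1); `δ*(2.057) ≤ 31.93` (δ/M = 15.522; v3 15.964 @ 2); `δ*(4.114) ≤ 70.62` (δ/M = 17.166; v3 17.655 @ 4).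
«Near-profiles this good EXIST»; UPPER bounds only; excludes nothing; nothing about NS regularity; 23843 / H3 OPEN.
-/

set_option linter.dupNamespace false

namespace Summit.NavierStokesRegularity.NavierStokesRegularity.Cruxes.ScarEnvelopeTypeI.ForcedTsai

/-- `δ*(257/1000) ≤ 961/250` ≈ 3.8440 at the EXACT `B₁₀` level `M = 0.257` (Type-I-tail class, exact closure, exact weight; δ/M = 14.957; the v3 row of the same vector: 15.376 @ 1/4). -/
theorem forcedTsaiModulusLE_algX_L1X_1o4 : ForcedTsaiModulusLE (257 / 1000 : ℝ) (961 / 250 : ℝ) := by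
  have h := algRowXL1Xr0.sound algRowXL1Xr0_checkX
  have hM : algRowXL1Xr0.M = (257 / 1000) := rfl
  have hδ : algRowXL1Xr0.δ = (961 / 250) := rfl
  rw [hM, hδ] at h
  push_cast at h
  exact h

/-- `δ*(257/500) ≤ 3851/500` ≈ 7.7020 at the EXACT `B₁₀` level `M = 0.514` (Type-I-tail class, exact closure, exact weight; δ/M = 14.984; the v3 row of the same vector: 15.404 @ 1/2). -/
theorem forcedTsaiModulusLE_algX_L1X_1o2 : ForcedTsaiModulusLE (257 / 500 : ℝ) (3851 / 500 : ℝ) := by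
  have h := algRowXL1Xr1.sound algRowXL1Xr1_checkX
  have hM : algRowXL1Xr1.M = (257 / 500) := rfl
  have hδ : algRowXL1Xr1.δ = (3851 / 500) := rfl
  rw [hM, hδ] at h
  push_cast at h
  exact h

/-- `δ*(257/250) ≤ 3879/250` ≈ 15.5160 at the EXACT `B₁₀` level `M = 1.028` (Type-I-tail class, exact closure, exact weight; δ/M = 15.093; the v3 row of the same vector: 15.516 @ 1). -/
theorem forcedTsaiModulusLE_algX_L1X_1 : ForcedTsaiModulusLE (257 / 250 : ℝ) (3879 / 250 : ℝ) := by
  have h := algRowXL1Xr2.sound algRowXL1Xr2_checkX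
  have hM : algRowXL1Xr2.M = (257 / 250) := rfl
  have hδ : algRowXL1Xr2.δ = (3879 / 250) := rfl
  rw [hM, hδ] at h
  push_cast at h
  exact h

/-- `δ*(2057/1000) ≤ 3991/125` ≈ 31.9280 at the EXACT `B₁₀` level `M = 2.057` (Type-I-tail class, exact closure, exact weight; δ/M = 15.522; the v3 row of the same vector: 15.964 @ 2). -/
theorem forcedTsaiModulusLE_algX_L1X_2 : ForcedTsaiModulusLE (2057 / 1000 : ℝ) (3991 / 125 : ℝ) := by
  have h := algRowXL1Xr3.sound algRowXL1Xr3_checkX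
  have hM : algRowXL1Xr3.M = (2057 / 1000) := rfl
  have hδ : algRowXL1Xr3.δ = (3991 / 125) := rfl
  rw [hM, hδ] at h
  push_cast at h
  exact h

/-- `δ*(2057/500) ≤ 35311/500` ≈ 70.6220 at the EXACT `B₁₀` level `M = 4.114` (Type-I-tail class, exact closure, exact weight; δ/M = 17.166; the v3 row of the same vector: 17.655 @ 4). -/
theorem forcedTsaiModulusLE_algX_L1X_4 : ForcedTsaiModulusLE (2057 / 500 : ℝ) (35311 / 500 : ℝ) := by
  have h := algRowXL1Xr4.sound algRowXL1Xr4_checkX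
  have hM : algRowXL1Xr4.M = (2057 / 500) := rfl
  have hδ : algRowXL1Xr4.δ = (35311 / 500) := rfl
  rw [hM, hδ] at h
  push_cast at h
  exact h

/-- Rounded: `ForcedTsaiModulusLE (257/1000) (77/20)` (`δ/M ≤ 14.99` at the exact level 0.257; ℓ = 1 Type-I family). -/
theorem forcedTsaiModulusLE_0p257_3p85 : ForcedTsaiModulusLE (257 / 1000 : ℝ) (77 / 20 : ℝ) :=
  forcedTsaiModulusLE_algX_L1X_1o4.mono le_rfl (by norm_num)

end Summit.NavierStokesRegularity.NavierStokesRegularity.Cruxes.ScarEnvelopeTypeI.ForcedTsai
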